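import Mathlib
import Literature.NumberTheory.Transcendental.KZCalculusProofs
import Literature.NumberTheory.Transcendental.KZLogCalculusProofs
import Literature.NumberTheory.Transcendental.KZSubcalculusInvariants
import Literature.NumberTheory.Transcendental.KZRelationsLE
import Summits.KontsevichZagierPeriods.KontsevichZagierPeriods.Theorems.HermiteRigidityGenusTwoCycleTransferPushforwardDimOne

/-!
# Stub `stub_lemniscateArc` — crux `OffTetraSectorKernel`, line `odd-hyperbolic-ladder` (skeleton v8, lead c6)

THE LEMNISCATE ARC IS A QUARTER OF EULER'S `β(¼,½)`. Let `R = [(0,1), (1 − x⁴)^{-1/2}]` be the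
lemniscate arc (value `∫₀¹ dx/√(1−x⁴) = ϖ₀/2`, half the lemniscatic constant) and let `H` be a
representation pinned as Euler's Beta carrier `β(¼,½) = [(0,1), t^{¼−1}(1−t)^{½−1}]` (value
`B(¼,½) = 2ϖ₀`). THEOREM (`stub_lemniscateArc`): `4·[R] − [H] ∈ KZ.relations`.

Proof: ONE change of variables `t = Φ(x) = x⁴` of `(0,1)` onto `(0,1)` (rule (2) of the
Kontsevich–Zagier calculus, `KZ.changeOfVariablesRel`), applied to the scaled representation
`4·R = R.constMul 4 = [(0,1), 4(1 − x⁴)^{-1/2}]` (source) with image `H`: the chart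
`x ↦ (fun _ => (x 0)⁴)` of `ℝ¹`

* is a `ℚ`-polynomial map, hence `ℚ`-semialgebraic;
* has derivative the homothety `4x³ • id`, so `|det| = 4x³` on `x > 0`;
* is injective on `x > 0` and maps `(0,1)` ONTO `(0,1)` (inverse `t ↦ t^{1/4}`);
* satisfies the pull-back identity `4(1 − x⁴)^{-1/2} = (x⁴)^{-3/4} (1 − x⁴)^{-1/2} · 4x³` on
  `0 < x < 1`, because `(x⁴)^{-3/4} = x^{-3}`.

Hence `[4·R] − [H] ∈ changeOfVariablesRel ⊆ relations`; and `[4·R] − 4·[R] ∈ relations` is integer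
scaling as integrand additivity (`KZ.IntegralRep.of_constMul_nat_sub_nsmul_mem_relations`).
Pattern of `HyperbolicBlochOffTetraSectorKernelStubArcWeierstrass.lean`; the one-dimensional
derivative/determinant bookkeeping is `GenusTwoCycleTransfer.hasFDerivAt_fin_one` /
`det_smul_id_fin_one` (HermiteRigidity). No definitions are introduced (the chart and its
derivative are written out), so that the file is a pure proof file.

References: M. Kontsevich, D. Zagier, *Periods* (2001), §1.2 rules (1), (2); H. McKean, V. Moll,
*Elliptic Curves* (1999), §2.3 (the lemniscatic integral as a Beta value).
-/

noncomputable section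

open Set MeasureTheory
open Literature.NumberTheory.Transcendental
open Literature.ModelTheory.ExponentialFields (IsSemialgebraic)
open MvPolynomial (aeval X)
open Summit.KontsevichZagierPeriods.HermiteRigidity.GenusTwoCycleTransfer
  (det_smul_id_fin_one hasFDerivAt_fin_one)

namespace Summit.KontsevichZagierPeriods.HyperbolicBloch.OffTetraSectorKernel

/-! ## Algebra of the quartic chart `Φ(x) = x⁴` -/

/-- `(s⁴)^{¼ − 1} = (s³)⁻¹` for `s > 0`, the exponent spelled `((1/4 : ℚ) : ℝ) − 1` as in the
pinned Beta integrand. [folklore] -/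
theorem lemArc_rpow_four_quarter_sub_one {s : ℝ} (hs : 0 < s) :
    (s ^ 4) ^ (((1 / 4 : ℚ) : ℝ) - 1) = (s ^ 3)⁻¹ := by
  rw [← Real.rpow_natCast s 4, ← Real.rpow_mul hs.le,
    show ((4 : ℕ) : ℝ) * (((1 / 4 : ℚ) : ℝ) - 1) = -((3 : ℕ) : ℝ) by norm_num,
    Real.rpow_neg hs.le, Real.rpow_natCast]

/-- `w^{½ − 1} = (√w)⁻¹` for `w ≥ 0`, the exponent spelled `((1/2 : ℚ) : ℝ) − 1` as in the pinned
Beta integrand. [folklore] -/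
theorem lemArc_rpow_half_sub_one {w : ℝ} (hw : 0 ≤ w) :
    w ^ (((1 / 2 : ℚ) : ℝ) - 1) = (Real.sqrt w)⁻¹ := by
  rw [show ((1 / 2 : ℚ) : ℝ) - 1 = -(1 / 2 : ℝ) by norm_num, Real.rpow_neg hw, Real.sqrt_eq_rpow]

/-- **The pull-back identity** of the quartic chart (Jacobian `|4x³|` included): for `0 < s < 1`,
`4/√(1 − s⁴) = (s⁴)^{¼−1} (1 − s⁴)^{½−1} · |4s³|`. [folklore] -/
theorem lemArc_kernel_identity {s : ℝ} (hs : 0 < s) (hs1 : s < 1) :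
    4 / Real.sqrt (1 - s ^ 4) =
      (s ^ 4) ^ (((1 / 4 : ℚ) : ℝ) - 1) * (1 - s ^ 4) ^ (((1 / 2 : ℚ) : ℝ) - 1) * |4 * s ^ 3| := by
  have h4 : 0 < 1 - s ^ 4 := sub_pos.2 (pow_lt_one₀ hs.le hs1 (by norm_num))
  have hA : 0 < Real.sqrt (1 - s ^ 4) := Real.sqrt_pos.2 h4
  have h3 : 0 < s ^ 3 := pow_pos hs 3
  rw [lemArc_rpow_four_quarter_sub_one hs, lemArc_rpow_half_sub_one h4.le,
    abs_of_pos (by positivity : (0:ℝ) < 4 * s ^ 3)]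
  field_simp

/-! ## The chart on `ℝ¹` -/

/-- The chart `x ↦ (fun _ => (x 0)⁴)` of `ℝ¹` has derivative the homothety `4(x 0)³ • id` at every
`x` (`hasDerivAt_pow` lifted by `GenusTwoCycleTransfer.hasFDerivAt_fin_one`). [folklore] -/
theorem lemArc_hasFDerivAt_chart (x : Fin 1 → ℝ) :
    HasFDerivAt (fun y : Fin 1 → ℝ => fun _ : Fin 1 => y 0 ^ 4)
      ((4 * x 0 ^ 3) • ContinuousLinearMap.id ℝ (Fin 1 → ℝ)) x :=
  hasFDerivAt_fin_one (fun s : ℝ => s ^ 4) _ x ((hasDerivAt_pow 4 (x 0)).congr_deriv (by norm_num))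

/-- The chart is injective on `(0,1)` (`s ↦ s⁴` is injective on `s ≥ 0`). [folklore] -/
theorem lemArc_injOn_chart :
    InjOn (fun y : Fin 1 → ℝ => fun _ : Fin 1 => y 0 ^ 4) {x : Fin 1 → ℝ | x 0 ∈ Ioo (0:ℝ) 1} := by
  intro x hx y hy hxy
  have h0x : 0 < x 0 := hx.1
  have h0y : 0 < y 0 := hy.1
  have e : x 0 ^ 4 = y 0 ^ 4 := congrFun hxy 0
  funext i
  obtain rfl : i = 0 := Fin.fin_one_eq_zero i
  exact (pow_left_inj₀ h0x.le h0y.le (by norm_num : (4:ℕ) ≠ 0)).1 e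

/-- The chart maps `(0,1)` ONTO `(0,1)` (`s⁴ ∈ (0,1)` for `s ∈ (0,1)`; inverse `t ↦ t^{1/4}`).
[folklore] -/
theorem lemArc_image_chart :
    (fun y : Fin 1 → ℝ => fun _ : Fin 1 => y 0 ^ 4) '' {x : Fin 1 → ℝ | x 0 ∈ Ioo (0:ℝ) 1} =
      {x : Fin 1 → ℝ | x 0 ∈ Ioo (0:ℝ) 1} := by
  ext y
  constructor
  · rintro ⟨x, hx, rfl⟩
    obtain ⟨h0, h1⟩ : 0 < x 0 ∧ x 0 < 1 := hx
    show x 0 ^ 4 ∈ Ioo (0:ℝ) 1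
    exact ⟨pow_pos h0 4, pow_lt_one₀ h0.le h1 (by norm_num)⟩
  · rintro ⟨hy0, hy1⟩
    refine ⟨fun _ => (y 0) ^ (((4:ℕ):ℝ)⁻¹), ?_, ?_⟩
    · show (y 0) ^ (((4:ℕ):ℝ)⁻¹) ∈ Ioo (0:ℝ) 1
      exact ⟨Real.rpow_pos_of_pos hy0 _,
        Real.rpow_lt_one hy0.le hy1 (inv_pos.2 (by exact_mod_cast Nat.succ_pos 3))⟩
    · funext i
      obtain rfl : i = 0 := Fin.fin_one_eq_zero i
      show ((y 0) ^ (((4:ℕ):ℝ)⁻¹)) ^ 4 = y 0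
      exact Real.rpow_inv_natCast_pow hy0.le (by norm_num)

/-- The chart is a `ℚ`-semialgebraic map on any `ℚ`-semialgebraic set (its single component is
the polynomial `X₀⁴`). [folklore] -/
theorem lemArc_isSemialgebraicMapOn_chart {s : Set (Fin 1 → ℝ)} (hs : IsSemialgebraic ℚ s) :
    IsSemialgebraicMapOn ℚ s (fun y : Fin 1 → ℝ => fun _ : Fin 1 => y 0 ^ 4) := by
  refine IsSemialgebraicMapOn.of_forall hs fun _ => ?_
  exact (isSemialgebraicFunOn_aeval hs (X 0 ^ 4)).congr fun x _ => by
    simp only [map_pow, MvPolynomial.aeval_X]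

/-! ## The move -/

/-- **`[(0,1), 4(1 − x⁴)^{-1/2}] ≡ [(0,1), t^{¼−1}(1−t)^{½−1}]`** for representations PINNED by
domain and integrand: ONE change of variables along `t = x⁴` (rule (2); source `r`, image `H`,
`|dt/dx| = 4x³`, pull-back identity `lemArc_kernel_identity`). Value identity
`4 · ϖ₀/2 = B(¼,½)`. [cite: KontsevichZagier2001, §1.2 rule (2)] -/
theorem lemArc_move (r H : KZ.IntegralRep 1) (hrd : r.domain = {t | t 0 ∈ Set.Ioo (0:ℝ) 1})
    (hri : Set.EqOn r.integrand (fun t => 4 / Real.sqrt (1 - t 0 ^ 4)) r.domain)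
    (hHd : H.domain = {t | t 0 ∈ Set.Ioo (0:ℝ) 1})
    (hHi : Set.EqOn H.integrand
      (fun t => (t 0) ^ (((1 / 4 : ℚ) : ℝ) - 1) * (1 - t 0) ^ (((1 / 2 : ℚ) : ℝ) - 1)) H.domain) :
    KZ.of r - KZ.of H ∈ KZ.relations := by
  -- the chart maps `r.domain = (0,1)` onto `H.domain = (0,1)`
  have himage : H.domain = (fun y : Fin 1 → ℝ => fun _ : Fin 1 => y 0 ^ 4) '' r.domain := by
    rw [hrd, lemArc_image_chart, hHd]
  have hinj : InjOn (fun y : Fin 1 → ℝ => fun _ : Fin 1 => y 0 ^ 4) r.domain := by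
    rw [hrd]
    exact lemArc_injOn_chart
  -- one change-of-variables move, source `r`, image `H`
  exact KZ.changeOfVariablesRel_subset_relations
    ⟨1, r, H, fun y : Fin 1 → ℝ => fun _ : Fin 1 => y 0 ^ 4,
      fun y : Fin 1 → ℝ => (4 * y 0 ^ 3) • ContinuousLinearMap.id ℝ (Fin 1 → ℝ),
      lemArc_isSemialgebraicMapOn_chart r.isSemialgebraic_domain,
      fun x _ => (lemArc_hasFDerivAt_chart x).hasFDerivWithinAt, hinj, himage,
      fun x hx => by
        -- the pull-back identity on `(0,1)`, Jacobian `|det DΦ| = 4x³` included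
        have hx' : 0 < x 0 ∧ x 0 < 1 := by
          rw [hrd] at hx
          exact hx
        have hΦx : (fun _ : Fin 1 => x 0 ^ 4) ∈ H.domain := by
          rw [hHd]
          exact ⟨pow_pos hx'.1 4, pow_lt_one₀ hx'.1.le hx'.2 (by norm_num)⟩
        dsimp only
        rw [hri hx, hHi hΦx, det_smul_id_fin_one]
        exact lemArc_kernel_identity hx'.1 hx'.2,
      rfl⟩

/-! ## The stub -/

/-- **STUB `stub_lemniscateArc`** (line `odd-hyperbolic-ladder` of crux
stmt-KontsevichZagierPeriods-10557): THE LEMNISCATE ARC LIES IN CHUDNOVSKY'S RING. For the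
lemniscate arc `R = [(0,1), (1 − x⁴)^{-1/2}]` (value `ϖ₀/2`) and any representation `H` pinned as
Euler's Beta carrier `β(¼,½) = [(0,1), t^{-3/4}(1−t)^{-1/2}]` (value `2ϖ₀`):
`4·[R] − [H] ∈ KZ.relations` — integer scaling `4·[R] ≡ [4·R]` (rule (1b)) followed by the single
rule-(2) move `t = x⁴` (`lemArc_move`). [cite: KontsevichZagier2001, §1.2 rule (2)] -/
theorem stub_lemniscateArc : ∀ (R H : KZ.IntegralRep 1), R.domain = {t | t 0 ∈ Set.Ioo (0:ℝ) 1} →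
    Set.EqOn R.integrand (fun t => 1 / Real.sqrt (1 - t 0 ^ 4)) R.domain →
    H.domain = {t | t 0 ∈ Set.Ioo (0:ℝ) 1} →
    Set.EqOn H.integrand (fun t => (t 0) ^ (((1 / 4 : ℚ) : ℝ) - 1) * (1 - t 0) ^ (((1 / 2 : ℚ) : ℝ) - 1)) H.domain →
    4 • KZ.of R - KZ.of H ∈ KZ.relations := by
  intro R H hRd hRi hHd hHi
  -- the scaled representation `4·R = [(0,1), 4/√(1 − x⁴)]`, source of the move
  have hri : Set.EqOn (R.constMul ((4:ℕ):ℝ) (isAlgebraic_nat 4)).integrand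
      (fun t => 4 / Real.sqrt (1 - t 0 ^ 4)) (R.constMul ((4:ℕ):ℝ) (isAlgebraic_nat 4)).domain := by
    intro x hx
    rw [KZ.IntegralRep.integrand_constMul]
    dsimp only
    rw [hRi hx]
    push_cast
    ring
  have h1 : KZ.of (R.constMul ((4:ℕ):ℝ) (isAlgebraic_nat 4)) - KZ.of H ∈ KZ.relations :=
    lemArc_move _ H (by rw [KZ.IntegralRep.domain_constMul, hRd]) hri hHd hHi
  have h2 : KZ.of (R.constMul ((4:ℕ):ℝ) (isAlgebraic_nat 4)) - 4 • KZ.of R ∈ KZ.relations :=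
    KZ.IntegralRep.of_constMul_nat_sub_nsmul_mem_relations R 4
  have e : 4 • KZ.of R - KZ.of H = (KZ.of (R.constMul ((4:ℕ):ℝ) (isAlgebraic_nat 4)) - KZ.of H) -
      (KZ.of (R.constMul ((4:ℕ):ℝ) (isAlgebraic_nat 4)) - 4 • KZ.of R) := by
    abel
  rw [e]
  exact KZ.relations.sub_mem h1 h2

end Summit.KontsevichZagierPeriods.HyperbolicBloch.OffTetraSectorKernel

end
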